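import Summits.Parity.GeneralizedHardyLittlewood.Theorems.GreenTaoLevelTwoGITwoCyclicInverseLocalBessel
import Mathlib.Algebra.Order.Chebyshev

/-!
# Route `GreenTaoLevelTwo`, crux `GITwo` (stmt-Parity-21275), line `birth`, stub `stub_cyclicInverse`:
# the dual local Bessel inequality (GT08a arXiv Cor. 41)

Thirtieth helper file toward the XL stub `stub_cyclicInverse` (B. Green, T. Tao, *An inverse
theorem for the Gowers `U³(G)` norm*, arXiv:math/0503014, Thm. 68 = PEMS 51 (2008) Thm. 12.8).
Block B7, arXiv Corollary 41: for `B = B(S,ρ)` regular (`d = #S ≥ 1`), `τ > 0`, `0 < η ≤ 1` and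
`A ⊆ B`, the large spectrum `Γ = {ζ : |Σ_{x∈A} e(xζ)| ≥ η #B}` is covered by the
`2¹⁶τd/η⁴`-neighbourhoods (in `‖·‖_{B(S,τρ)}`) of at most `2/η²` frequencies: a maximal
`δ`-separated subset `F ⊆ Γ` covers `Γ`, and the local Bessel inequality (arXiv Cor. 40,
`sum_norm_sq_sum_le_of_separated`) with `δ = 2¹⁶τd/η⁴` (so `64(τd/δ)^{1/2} = η²/4`) and
Cauchy–Schwarz bound `#F`.

* `exists_maximal_separated` — a maximal pairwise-`R`-separated subset of a finset covers it
  (abstract, for any reflexive-free symmetric "close" relation given as a predicate);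
* `norm_toAddCircle_mul_sub_comm` — `‖y(ζ'−ζ)‖ = ‖y(ζ−ζ')‖`;
* `card_le_of_separated_subset_spec` — for `F ⊆ Γ` pairwise `δ`-separated, `δ = 2¹⁶τd/η⁴`:
  `#F ≤ 2/η²`;
* `exists_cover_largeSpec` — **arXiv Cor. 41** as displayed.

References: [GreenTao2008U3Inverse] arXiv:math/0503014, Cor. 41.
-/

noncomputable section

namespace Summit.Parity.GeneralizedHardyLittlewood.GreenTaoLevelTwoGITwoCyclicInverse

open Finset

open scoped ComplexConjugate

variable {N : ℕ} [NeZero N]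

omit [NeZero N] in
/-- A maximal pairwise-separated subset covers: for a finset `Γ` and a symmetric relation `close`,
there is `F ⊆ Γ`, pairwise not-close, such that every element of `Γ` is close to (or equal to) an
element of `F`. [folklore] -/
theorem exists_maximal_separated {α : Type*} [DecidableEq α] (Γ : Finset α) (close : α → α → Prop)
    (hsymm : ∀ a b, close a b → close b a) :
    ∃ F ⊆ Γ, (∀ a ∈ F, ∀ b ∈ F, a ≠ b → ¬close a b) ∧ ∀ a ∈ Γ, ∃ b ∈ F, a = b ∨ close a b := by
  classical
  set P : Finset α → Prop := fun F => F ⊆ Γ ∧ ∀ a ∈ F, ∀ b ∈ F, a ≠ b → ¬close a b with hP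
  have hne : (Γ.powerset.filter P).Nonempty :=
    ⟨∅, by rw [mem_filter]; exact ⟨empty_mem_powerset Γ, empty_subset Γ, by simp⟩⟩
  obtain ⟨F, hF, hmax⟩ := exists_max_image (Γ.powerset.filter P) card hne
  rw [mem_filter] at hF
  obtain ⟨-, hFΓ, hFsep⟩ := hF
  refine ⟨F, hFΓ, hFsep, fun a ha => ?_⟩
  by_contra hcov
  push Not at hcov
  -- `insert a F` is a larger separated subset
  have haF : a ∉ F := fun h => (hcov a h).1 rfl
  have hP' : P (insert a F) := by
    refine ⟨insert_subset ha hFΓ, fun x hx y hy hxy => ?_⟩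
    rw [mem_insert] at hx hy
    rcases hx with rfl | hx <;> rcases hy with rfl | hy
    · exact absurd rfl hxy
    · exact (hcov y hy).2
    · exact fun h => (hcov x hx).2 (hsymm _ _ h)
    · exact hFsep x hx y hy hxy
  have hle := hmax (insert a F) (by rw [mem_filter, mem_powerset]; exact ⟨hP'.1, hP'⟩)
  rw [card_insert_of_notMem haF] at hle
  omega

/-- `‖y(ζ'−ζ)‖_{ℝ/ℤ} = ‖y(ζ−ζ')‖_{ℝ/ℤ}`. [folklore] -/
theorem norm_toAddCircle_mul_sub_comm (y ζ ζ' : ZMod N) :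
    ‖ZMod.toAddCircle (y * (ζ' - ζ))‖ = ‖ZMod.toAddCircle (y * (ζ - ζ'))‖ := by
  rw [← neg_sub, mul_neg, map_neg, norm_neg]

/-- **The count in GT08a arXiv Cor. 41.**  For `S` nonempty (`d = #S`), `ρ > 0`, `B = B(S,ρ)`
regular, `τ > 0`, `η > 0`, `A ⊆ B`, and `F` a finset of frequencies in the large spectrum
(`η #B ≤ ‖Σ_{x∈A} e(xζ)‖` for `ζ ∈ F`) which is pairwise `δ`-separated in `‖·‖_{B(S,τρ)}` with
`δ = 2¹⁶ τ d/η⁴`: `#F ≤ 2/η²`. [cite: GreenTao2008U3Inverse, Cor. 41 (proof)] -/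
theorem card_le_of_separated_subset_spec (S : Finset (ZMod N)) (hS : S.Nonempty) {ρ τ η : ℝ}
    (hρ : 0 < ρ) (hτ : 0 < τ) (hη : 0 < η)
    (hreg : ∀ κ : ℝ, |κ| ≤ 1 / (100 * (#S : ℝ)) →
      (1 - 100 * (#S : ℝ) * |κ|) * #{x : ZMod N | ∀ ξ ∈ S, ‖ZMod.toAddCircle (x * ξ)‖ < ρ} ≤
          #{x : ZMod N | ∀ ξ ∈ S, ‖ZMod.toAddCircle (x * ξ)‖ < (1 + κ) * ρ} ∧
        (#{x : ZMod N | ∀ ξ ∈ S, ‖ZMod.toAddCircle (x * ξ)‖ < (1 + κ) * ρ} : ℝ) ≤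
          (1 + 100 * (#S : ℝ) * |κ|) * #{x : ZMod N | ∀ ξ ∈ S, ‖ZMod.toAddCircle (x * ξ)‖ < ρ})
    {A : Finset (ZMod N)}
    (hA : A ⊆ ({x : ZMod N | ∀ ξ ∈ S, ‖ZMod.toAddCircle (x * ξ)‖ < ρ} : Finset (ZMod N)))
    (F : Finset (ZMod N))
    (hFspec : ∀ ζ ∈ F, η * #{x : ZMod N | ∀ ξ ∈ S, ‖ZMod.toAddCircle (x * ξ)‖ < ρ} ≤
      ‖∑ x ∈ A, (ZMod.stdAddChar (x * ζ) : ℂ)‖)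
    (hsep : ∀ ζ ∈ F, ∀ ζ' ∈ F, ζ ≠ ζ' → ∃ y : ZMod N,
      (∀ ξ' ∈ S, ‖ZMod.toAddCircle (y * ξ')‖ < τ * ρ) ∧
        2 ^ 16 * τ * #S / η ^ 4 ≤ ‖ZMod.toAddCircle (y * (ζ - ζ'))‖) :
    (#F : ℝ) ≤ 2 / η ^ 2 := by
  classical
  set B : Finset (ZMod N) := {x : ZMod N | ∀ ξ ∈ S, ‖ZMod.toAddCircle (x * ξ)‖ < ρ} with hBdef
  set c : ℝ := (#B : ℝ) with hc
  have hc1 : 1 ≤ c := by rw [hc]; exact_mod_cast one_le_card_bohr S hρ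
  have hc0 : 0 < c := by linarith
  set δ : ℝ := 2 ^ 16 * τ * #S / η ^ 4 with hδ
  have hd1 : (1 : ℝ) ≤ #S := by exact_mod_cast Nat.one_le_iff_ne_zero.mpr (card_pos.mpr hS).ne'
  have hδ0 : 0 < δ := by positivity
  -- the phases `b ζ = conj T_ζ / ‖T_ζ‖`
  set T : ZMod N → ℂ := fun ζ => ∑ x ∈ A, (ZMod.stdAddChar (x * ζ) : ℂ) with hT
  have hTpos : ∀ ζ ∈ F, 0 < ‖T ζ‖ := fun ζ hζ =>
    lt_of_lt_of_le (by positivity) (hFspec ζ hζ)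
  set b : ZMod N → ℂ := fun ζ => conj (T ζ) / (‖T ζ‖ : ℂ) with hb
  have hb1 : ∀ ζ ∈ F, ‖b ζ‖ ≤ 1 := fun ζ hζ => by
    rw [hb]
    simp only
    rw [norm_div, Complex.norm_conj, Complex.norm_real, Real.norm_eq_abs,
      abs_of_pos (hTpos ζ hζ), div_self (hTpos ζ hζ).ne']
  have hbT : ∀ ζ ∈ F, b ζ * T ζ = (‖T ζ‖ : ℂ) := fun ζ hζ => by
    rw [hb]
    simp only
    have hne : (‖T ζ‖ : ℂ) ≠ 0 := by exact_mod_cast (hTpos ζ hζ).ne'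
    rw [div_mul_eq_mul_div, div_eq_iff hne, mul_comm (conj (T ζ)), Complex.mul_conj,
      Complex.normSq_eq_norm_sq]
    push_cast; ring
  -- `k η c ≤ Σ_ζ ‖T_ζ‖ = Σ_{x∈A} P x` with `P x = Σ_ζ b_ζ e(xζ)`
  set P : ZMod N → ℂ := fun x => ∑ ζ ∈ F, b ζ * ZMod.stdAddChar (x * ζ) with hP
  have hsumP : ∑ x ∈ A, P x = ∑ ζ ∈ F, (‖T ζ‖ : ℂ) := by
    rw [hP]
    simp only
    rw [sum_comm]
    refine sum_congr rfl fun ζ hζ => ?_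
    rw [← mul_sum, hbT ζ hζ]
  have hlow : (#F : ℝ) * (η * c) ≤ ∑ x ∈ A, ‖P x‖ := by
    calc (#F : ℝ) * (η * c) = ∑ ζ ∈ F, η * c := by rw [sum_const, nsmul_eq_mul]
      _ ≤ ∑ ζ ∈ F, ‖T ζ‖ := sum_le_sum fun ζ hζ => hFspec ζ hζ
      _ = ‖((∑ ζ ∈ F, ‖T ζ‖ : ℝ) : ℂ)‖ := by
          rw [Complex.norm_real, Real.norm_eq_abs, abs_of_nonneg (sum_nonneg fun _ _ => norm_nonneg _)]
      _ = ‖∑ x ∈ A, P x‖ := by push_cast; rw [hsumP]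
      _ ≤ ∑ x ∈ A, ‖P x‖ := norm_sum_le _ _
  -- Cauchy–Schwarz and `A ⊆ B`
  have hCS : (∑ x ∈ A, ‖P x‖) ^ 2 ≤ #A * ∑ x ∈ A, ‖P x‖ ^ 2 := sq_sum_le_card_mul_sum_sq
  have hAB : (#A : ℝ) ≤ c := by rw [hc]; exact_mod_cast card_le_card hA
  have hAB2 : ∑ x ∈ A, ‖P x‖ ^ 2 ≤ ∑ x ∈ B, ‖P x‖ ^ 2 :=
    sum_le_sum_of_subset_of_nonneg hA fun _ _ _ => by positivity
  -- the local Bessel inequality with `64 (τ d/δ)^{1/2} = η²/4`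
  have hsqrt : 64 * Real.sqrt (τ * #S / δ) = η ^ 2 / 4 := by
    have : τ * #S / δ = (η ^ 2 / 256) ^ 2 := by
      rw [hδ]; field_simp; ring
    rw [this, Real.sqrt_sq (by positivity)]; ring
  have h40 := sum_norm_sq_sum_le_of_separated S hS hρ hτ hδ0 hreg F b hb1 hsep
  rw [hsqrt] at h40
  -- combine: `(k η c)² ≤ c · (k + k² η²/4) c`
  have hk : ((#F : ℝ) * (η * c)) ^ 2 ≤ c * (((#F : ℝ) + (#F : ℝ) ^ 2 * (η ^ 2 / 4)) * c) := by
    calc ((#F : ℝ) * (η * c)) ^ 2 ≤ (∑ x ∈ A, ‖P x‖) ^ 2 := by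
          exact pow_le_pow_left₀ (by positivity) hlow 2
      _ ≤ #A * ∑ x ∈ A, ‖P x‖ ^ 2 := hCS
      _ ≤ c * ∑ x ∈ B, ‖P x‖ ^ 2 := by
          exact mul_le_mul hAB hAB2 (sum_nonneg fun _ _ => by positivity) hc0.le
      _ ≤ c * (((#F : ℝ) + (#F : ℝ) ^ 2 * (η ^ 2 / 4)) * c) :=
          mul_le_mul_of_nonneg_left h40 hc0.le
  -- `k² η² ≤ k + k² η²/4`, hence `k ≤ 4/(3η²) ≤ 2/η²`
  have hk2 : (#F : ℝ) ^ 2 * η ^ 2 ≤ (#F : ℝ) + (#F : ℝ) ^ 2 * (η ^ 2 / 4) := by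
    have hcc : 0 < c * c := by positivity
    nlinarith
  rw [le_div_iff₀ (by positivity)]
  rcases Nat.eq_zero_or_pos #F with h0 | hpos
  · rw [h0]; simp
  · have h1 : (1 : ℝ) ≤ #F := by exact_mod_cast hpos
    nlinarith

/-- **Dual local Bessel inequality (GT08a arXiv Cor. 41).**  For `S` nonempty (`d = #S`), `ρ > 0`,
`B = B(S,ρ)` regular, `τ > 0`, `η > 0` and `A ⊆ B`: there is a finset `F` of at most `2/η²`
frequencies such that every `ζ` in the large spectrum `{η #B ≤ ‖Σ_{x∈A} e(xζ)‖}` is within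
`2¹⁶τd/η⁴` of some `ζ' ∈ F` in `‖·‖_{B(S,τρ)}`: `‖y(ζ−ζ')‖_{ℝ/ℤ} ≤ 2¹⁶τd/η⁴` for all
`y ∈ B(S,τρ)`. [cite: GreenTao2008U3Inverse, Cor. 41] -/
theorem exists_cover_largeSpec (S : Finset (ZMod N)) (hS : S.Nonempty) {ρ τ η : ℝ}
    (hρ : 0 < ρ) (hτ : 0 < τ) (hη : 0 < η)
    (hreg : ∀ κ : ℝ, |κ| ≤ 1 / (100 * (#S : ℝ)) →
      (1 - 100 * (#S : ℝ) * |κ|) * #{x : ZMod N | ∀ ξ ∈ S, ‖ZMod.toAddCircle (x * ξ)‖ < ρ} ≤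
          #{x : ZMod N | ∀ ξ ∈ S, ‖ZMod.toAddCircle (x * ξ)‖ < (1 + κ) * ρ} ∧
        (#{x : ZMod N | ∀ ξ ∈ S, ‖ZMod.toAddCircle (x * ξ)‖ < (1 + κ) * ρ} : ℝ) ≤
          (1 + 100 * (#S : ℝ) * |κ|) * #{x : ZMod N | ∀ ξ ∈ S, ‖ZMod.toAddCircle (x * ξ)‖ < ρ})
    {A : Finset (ZMod N)}
    (hA : A ⊆ ({x : ZMod N | ∀ ξ ∈ S, ‖ZMod.toAddCircle (x * ξ)‖ < ρ} : Finset (ZMod N))) :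
    ∃ F : Finset (ZMod N), (#F : ℝ) ≤ 2 / η ^ 2 ∧
      ∀ ζ : ZMod N, η * #{x : ZMod N | ∀ ξ ∈ S, ‖ZMod.toAddCircle (x * ξ)‖ < ρ} ≤
          ‖∑ x ∈ A, (ZMod.stdAddChar (x * ζ) : ℂ)‖ →
        ∃ ζ' ∈ F, ∀ y : ZMod N, (∀ ξ' ∈ S, ‖ZMod.toAddCircle (y * ξ')‖ < τ * ρ) →
          ‖ZMod.toAddCircle (y * (ζ - ζ'))‖ ≤ 2 ^ 16 * τ * #S / η ^ 4 := by
  classical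
  set Γ : Finset (ZMod N) := {ζ : ZMod N | η * #{x : ZMod N | ∀ ξ ∈ S,
      ‖ZMod.toAddCircle (x * ξ)‖ < ρ} ≤ ‖∑ x ∈ A, (ZMod.stdAddChar (x * ζ) : ℂ)‖} with hΓ
  set close : ZMod N → ZMod N → Prop := fun ζ ζ' => ∀ y : ZMod N,
      (∀ ξ' ∈ S, ‖ZMod.toAddCircle (y * ξ')‖ < τ * ρ) →
        ‖ZMod.toAddCircle (y * (ζ - ζ'))‖ ≤ 2 ^ 16 * τ * #S / η ^ 4 with hclose
  have hsymm : ∀ a b, close a b → close b a := fun a b h y hy => by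
    have := h y hy
    rw [norm_toAddCircle_mul_sub_comm]
    exact this
  obtain ⟨F, hFΓ, hFsep, hcov⟩ := exists_maximal_separated Γ close hsymm
  refine ⟨F, ?_, fun ζ hζ => ?_⟩
  · refine card_le_of_separated_subset_spec S hS hρ hτ hη hreg hA F (fun ζ hζ => ?_)
      (fun ζ hζ ζ' hζ' hne => ?_)
    · have := hFΓ hζ
      rw [hΓ, mem_filter] at this
      exact this.2
    · have h := hFsep ζ hζ ζ' hζ' hne
      rw [hclose] at h
      simp only [not_forall, not_le, exists_prop] at h
      obtain ⟨y, hy, hlt⟩ := h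
      exact ⟨y, hy, hlt.le⟩
  · have hζΓ : ζ ∈ Γ := by rw [hΓ, mem_filter]; exact ⟨mem_univ _, hζ⟩
    obtain ⟨ζ', hζ'F, h⟩ := hcov ζ hζΓ
    refine ⟨ζ', hζ'F, ?_⟩
    rcases h with rfl | h
    · intro y _
      rw [sub_self, mul_zero, map_zero, norm_zero]; positivity
    · exact h

end Summit.Parity.GeneralizedHardyLittlewood.GreenTaoLevelTwoGITwoCyclicInverse
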